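import Literature.AlgebraicGeometry.Frobenioids.ModelFrobenioidIsFrobenioid
import Literature.AlgebraicGeometry.Frobenioids.FrTrFrobenioid
import Literature.AlgebraicGeometry.Frobenioids.Thm36Sub
import Literature.AlgebraicGeometry.Frobenioids.RealificationPicLemmas
import Mathlib.CategoryTheory.SingleObj
import Mathlib.Analysis.SpecialFunctions.Log.Basic
import HarnessLib

/-!
# [FrdI] Theorem 4.2 (i), row T42-L02 as typed (`FrdI.T42.PreservesDivFrobTrivial`): a DILATING model
# Frobenioid — part 1, the model (kernel counter-model of the abc-iut cell, FACT-LIST row F-2398)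

Mochizuki, *The geometry of Frobenioids I: the general theory*, Kyushu J. Math. **62** (2008)
293–400, §4, Theorem 4.2 (i), proof p. 78 ll. 36–38; Definition 1.1 (i)/(ii) p. 19 (non-dilating
monoids); Definition 3.1 (i)(e) p. 56 (standard type requires `Φ` non-dilating); Theorem 5.2 (i)(ii)
pp. 100–101 (model Frobenioids) [cite: MochizukiFrdI2008, Thm. 4.2 (i) p.78].

OURS (abc-iut cell, F wave seat f-050; NOT a construction of the paper). The statements file `Thm42Sub.lean`
(seat abc-iut-L1-t14) types row T42-L02 as the closed `Prop` `FrdI.T42.PreservesDivFrobTrivial`,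
quantified over `FrdI.T42.Setting F₁ F₂ Ψ` ONLY; print obtains its clause (a) ("`Ψ` preserves Div-identity
prime-Frobenius endomorphisms") from Prop. 1.14 (v), whose sufficiency uses that `Φ₂` is NON-DILATING —
hypothesis (e) of "standard type" in Thm. 4.2, not a field of `Setting`. The repaired statement (with
`IsNonDilatingOn Φ₂`) is PROVED in the tree (`FrdI.T42.preservesDivFrobTrivial_of_nonDilating`,
`Thm42Assembly.lean`). This file and its sequel `Thm42PreservesDivFrobTrivialCounterexample.lean` record,
kernel-checked, that the slot AS TYPED is FALSE at universe level `0`.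

THE MODEL (this file). Base `D := B Γ`, the one-object groupoid of `Γ := (ℝ, +)` (written multiplicatively);
divisor monoid `Φ ≡ ℝ_{≥0}` with `t ∈ Γ` pulling back by the DILATION `x ↦ e^t · x` (so `Φ` is a divisorial,
perf-factorial monoid on `D` that is NOT non-dilating); rational function monoid `0_D`. The model Frobenioid
`C := ModelFrobenioid Φ 0_D 0` of Thm. 5.2 is a Frobenioid (`ModelFrobenioid.isFrobenioid`, abc-iut-found) of
isotropic type (Thm. 5.2 (ii)) and — `ℝ_{≥0}` being divisible — of PERFECT type (`isOfPerfectType`). Objects are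
`(∗, [a])`, `a ∈ ℝ ≅ (ℝ_{≥0})^gp` (`crd`); an arrow `(∗,[a]) → (∗,[b])` is `(n, t, Z)` with `n·a + Z = e^t·b`
(`rel_crd`), and is determined by `(n, t)` (`hom_eq`). Dictionary: pre-step ⟺ `n = 1`; isomorphism ⟺
`n = 1 ∧ Z = 0`; Frobenius type ⟺ `Z = 0`; pull-back morphism ⟺ isomorphism; Div-identity ⟺ `t = 0`.
Neutral record under the cell's typing; nothing here bears on [IUTchIII] Cor. 3.12.
-/

noncomputable section

namespace Literature.AlgebraicGeometry.Frobenioids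

open CategoryTheory Opposite Function
open scoped NNReal

namespace FrdI.T42.DilatingWitness

/-! ### The base `D = BΓ`, `Γ = (ℝ, +)`, and the dilating divisor monoid `Φ ≡ ℝ_{≥0}` -/

/-- `Γ := (ℝ, +)` written multiplicatively. [cite: MochizukiFrdI2008, Def. 1.1(ii) p.19] -/
abbrev Γ : Type := Multiplicative ℝ

/-- The base category `D := BΓ` (one object, automorphism group `Γ`). [cite: MochizukiFrdI2008, Def. 1.1(ii) p.19] -/
abbrev D : Type := SingleObj Γ

/-- The dilation factor `e^t ∈ ℝ_{>0}` of `t ∈ Γ`. [cite: MochizukiFrdI2008, Def. 1.1(ii) p.19] -/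
def c (t : Γ) : ℝ≥0 := ⟨Real.exp (Multiplicative.toAdd t), (Real.exp_pos _).le⟩

/-- `c t` as a real number. [cite: MochizukiFrdI2008, Def. 1.1(ii) p.19] -/
theorem coe_c (t : Γ) : (c t : ℝ) = Real.exp (Multiplicative.toAdd t) := rfl

/-- `c` is positive. [cite: MochizukiFrdI2008, Def. 1.1(ii) p.19] -/
theorem c_pos (t : Γ) : 0 < (c t : ℝ) := Real.exp_pos _

/-- `c t ≠ 0` in `ℝ`. [cite: MochizukiFrdI2008, Def. 1.1(ii) p.19] -/
theorem c_ne_zero (t : Γ) : (c t : ℝ) ≠ 0 := (c_pos t).ne'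

/-- `c 1 = 1`. [cite: MochizukiFrdI2008, Def. 1.1(ii) p.19] -/
theorem c_one : c 1 = 1 :=
  NNReal.coe_injective (by rw [coe_c, toAdd_one, Real.exp_zero, NNReal.coe_one])

/-- `c (s t) = c s · c t`. [cite: MochizukiFrdI2008, Def. 1.1(ii) p.19] -/
theorem c_mul (s t : Γ) : c (s * t) = c s * c t :=
  NNReal.coe_injective (by rw [NNReal.coe_mul, coe_c, coe_c, coe_c, toAdd_mul, Real.exp_add])

/-- The value `v x ∈ ℝ` of a divisor element `x ∈ Φ(∗) = ℝ_{≥0}`. [cite: MochizukiFrdI2008, Def. 1.1(i) p.19] -/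
def v (x : Multiplicative ℝ≥0) : ℝ := ((Multiplicative.toAdd x : ℝ≥0) : ℝ)

/-- `v` is injective. [cite: MochizukiFrdI2008, Def. 1.1(i) p.19] -/
theorem v_injective : Injective v := fun _ _ h => Multiplicative.toAdd.injective (NNReal.coe_injective h)

/-- `v x ≥ 0`. [cite: MochizukiFrdI2008, Def. 1.1(i) p.19] -/
theorem v_nonneg (x : Multiplicative ℝ≥0) : 0 ≤ v x := NNReal.coe_nonneg _

/-- `v 0 = 0` (multiplicatively `v 1 = 0`). [cite: MochizukiFrdI2008, Def. 1.1(i) p.19] -/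
theorem v_one : v 1 = 0 := by rw [v, toAdd_one, NNReal.coe_zero]

/-- `v x = 0 ↔ x = 0`. [cite: MochizukiFrdI2008, Def. 1.1(i) p.19] -/
theorem v_eq_zero_iff (x : Multiplicative ℝ≥0) : v x = 0 ↔ x = 1 := by
  rw [← v_one]; exact v_injective.eq_iff

/-- `v (x + y) = v x + v y`. [cite: MochizukiFrdI2008, Def. 1.1(i) p.19] -/
theorem v_mul (x y : Multiplicative ℝ≥0) : v (x * y) = v x + v y := by rw [v, toAdd_mul, NNReal.coe_add]; rfl

/-- `v (n · x) = n · v x`. [cite: MochizukiFrdI2008, Def. 1.1(i) p.19] -/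
theorem v_pow (x : Multiplicative ℝ≥0) (n : ℕ) : v (x ^ n) = n * v x := by
  rw [v, toAdd_pow, NNReal.coe_nsmul, nsmul_eq_mul]; rfl

/-- The divisor element with value `r ≥ 0`. [cite: MochizukiFrdI2008, Def. 1.1(i) p.19] -/
def ofReal (r : ℝ) (hr : 0 ≤ r) : Multiplicative ℝ≥0 := Multiplicative.ofAdd ⟨r, hr⟩

/-- `v (ofReal r) = r`. [cite: MochizukiFrdI2008, Def. 1.1(i) p.19] -/
@[simp] theorem v_ofReal (r : ℝ) (hr : 0 ≤ r) : v (ofReal r hr) = r := rfl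

/-- The dilation `x ↦ a · x` of `ℝ_{≥0}` (a monoid endomorphism of `(ℝ_{≥0}, +)`).
[cite: MochizukiFrdI2008, Def. 1.1(i) p.19] -/
def scale (a : ℝ≥0) : Multiplicative ℝ≥0 →* Multiplicative ℝ≥0 where
  toFun x := Multiplicative.ofAdd (a * Multiplicative.toAdd x)
  map_one' := by rw [toAdd_one, mul_zero, ofAdd_zero]
  map_mul' x y := by rw [toAdd_mul, mul_add, ofAdd_add]

/-- `v (scale a x) = a · v x`. [cite: MochizukiFrdI2008, Def. 1.1(i) p.19] -/
theorem v_scale (a : ℝ≥0) (x : Multiplicative ℝ≥0) : v (scale a x) = a * v x := NNReal.coe_mul a _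

/-- `scale 1 = id`. [cite: MochizukiFrdI2008, Def. 1.1(i) p.19] -/
theorem scale_one : scale 1 = MonoidHom.id _ :=
  MonoidHom.ext fun x => v_injective (by rw [v_scale, NNReal.coe_one, one_mul]; rfl)

/-- `scale (a b) = scale b ∘ scale a`. [cite: MochizukiFrdI2008, Def. 1.1(i) p.19] -/
theorem scale_mul (a b : ℝ≥0) : scale (a * b) = (scale b).comp (scale a) :=
  MonoidHom.ext fun x => v_injective (by
    rw [MonoidHom.comp_apply, v_scale, v_scale, v_scale, NNReal.coe_mul, mul_comm (a : ℝ), mul_assoc])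

/-- **The dilating divisor monoid** `Φ ≡ ℝ_{≥0}` on `BΓ`: `t` pulls back by `x ↦ e^t · x` (transparent, so
that `Φ(∗)` computes to `ℝ_{≥0}`). [cite: MochizukiFrdI2008, Def. 1.1(ii) p.19] -/
abbrev Φ : Dᵒᵖ ⥤ CommMonCat.{0} where
  obj _ := CommMonCat.of (Multiplicative ℝ≥0)
  map f := CommMonCat.ofHom (scale (c f.unop))
  map_id X := by
    apply CommMonCat.hom_ext
    rw [CommMonCat.hom_ofHom, CommMonCat.hom_id]
    change scale (c (1 : Γ)) = MonoidHom.id (Multiplicative ℝ≥0)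
    rw [c_one, scale_one]
  map_comp f g := by
    apply CommMonCat.hom_ext
    rw [CommMonCat.hom_ofHom, CommMonCat.hom_comp, CommMonCat.hom_ofHom, CommMonCat.hom_ofHom]
    exact (congrArg scale (c_mul (show Γ from f.unop) (show Γ from g.unop))).trans (scale_mul _ _)

/-- The pull-back maps of `Φ`: `v (t^* x) = e^t · v x`. [cite: MochizukiFrdI2008, Def. 1.1(ii) p.19] -/
theorem v_pull {X Y : D} (t : X ⟶ Y) (x : Φ.obj (op Y)) : v (pull Φ t x) = c t * v x := v_scale _ _

/-- The pull-back maps of `Φ` are bijective. [cite: MochizukiFrdI2008, Def. 1.1(ii) p.19] -/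
theorem pull_Φ_bijective {X Y : D} (t : X ⟶ Y) : Bijective (pull Φ t) := by
  constructor
  · intro x y h
    have h' := congrArg v h
    rw [v_pull, v_pull] at h'
    exact v_injective (mul_left_cancel₀ (c_ne_zero t) h')
  · intro y
    refine ⟨ofReal ((c t : ℝ)⁻¹ * v y) (mul_nonneg (inv_nonneg.2 (c_pos t).le) (v_nonneg _)),
      v_injective ?_⟩
    rw [v_pull, v_ofReal, ← mul_assoc, mul_inv_cancel₀ (c_ne_zero t), one_mul]

/-- `Φ ≡ ℝ_{≥0}` is objectwise divisorial. [cite: MochizukiFrdI2008, Def. 1.1(i) p.19] -/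
theorem isDivisorial_Φ : Objectwise (fun M _ => IsDivisorial M) FrdI.T42.DilatingWitness.Φ := fun _ => ArchFrd.isPerfFactorial_nnreal.isDivisorial

/-- `Φ ≡ ℝ_{≥0}` is objectwise perf-factorial (Def. 2.4 (i); `ℝ_{≥0}` is `ℝ`-monoprime).
[cite: MochizukiFrdI2008, Def. 2.4(i) p.47] -/
theorem perfFactorial_Φ : Objectwise (fun M _ => IsPerfFactorial M) FrdI.T42.DilatingWitness.Φ := fun _ => ArchFrd.isPerfFactorial_nnreal

/-- `Φ` is a monoid on `BΓ` (Def. 1.1 (ii)): its pull-back maps are bijections of a sharp monoid.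
[cite: MochizukiFrdI2008, Def. 1.1(ii) p.19] -/
theorem isMonoidOn_Φ : IsMonoidOn FrdI.T42.DilatingWitness.Φ := by
  refine ⟨fun {X Y} t => ⟨(pull_Φ_bijective t).1, fun x y hxy => ?_⟩, fun {X Y} t _ => pull_Φ_bijective t⟩
  obtain ⟨a, rfl⟩ := Associates.mk_surjective x
  obtain ⟨b, rfl⟩ := Associates.mk_surjective y
  rw [associatesMap_mk, associatesMap_mk, Associates.mk_eq_mk_iff_associated] at hxy
  obtain ⟨u, hu⟩ := hxy
  rw [(isDivisorial_Φ Y).isSharp.1 _ u.isUnit, mul_one] at hu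
  rw [(pull_Φ_bijective t).1 hu]

/-- **`Φ` is NOT non-dilating** (Def. 1.1 (i)/(ii)): the endomorphism `t = log 2` of `∗` induces the dilation
`x ↦ 2x` of `ℝ_{≥0} = ℝ_{≥0}^{char}`, which satisfies `2x ≼ x` for every `x` but is not the identity.
[cite: MochizukiFrdI2008, Def. 1.1(ii) p.19] -/
theorem not_isNonDilatingOn_Φ : ¬ IsNonDilatingOn FrdI.T42.DilatingWitness.Φ := by
  intro h
  let t : (SingleObj.star Γ : D) ⟶ SingleObj.star Γ := Multiplicative.ofAdd (Real.log 2)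
  have hct : (c t : ℝ) = 2 := by
    rw [coe_c]
    exact (congrArg Real.exp (toAdd_ofAdd _)).trans (Real.exp_log two_pos)
  have hid := h (SingleObj.star Γ) t (fun a _ => by
    obtain ⟨x, rfl⟩ := Associates.mk_surjective a
    rw [associatesMap_mk]
    refine ⟨2, two_pos, ?_⟩
    rw [← Associates.mk_pow, Associates.mk_dvd_mk]
    refine ⟨1, v_injective ?_⟩
    show v ((show Multiplicative ℝ≥0 from x) ^ 2) = v ((show Multiplicative ℝ≥0 from pull Φ t x) * 1)
    rw [v_pow, v_mul, v_pull, v_one, add_zero, hct, Nat.cast_ofNat])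
  have h1 := congrArg (fun g => g (Associates.mk (ofReal 1 zero_le_one))) hid
  simp only [associatesMap_mk, MonoidHom.id_apply, Associates.mk_eq_mk_iff_associated] at h1
  obtain ⟨u, hu⟩ := h1
  rw [(isDivisorial_Φ (SingleObj.star Γ)).isSharp.1 _ u.isUnit, mul_one] at hu
  have h2 := congrArg v hu
  rw [v_pull, hct, v_ofReal, mul_one] at h2
  norm_num at h2


/-- `c t⁻¹ · c t = 1` in `ℝ`. [cite: MochizukiFrdI2008, Def. 1.1(ii) p.19] -/
theorem c_inv_mul (t : Γ) : (c t⁻¹ : ℝ) * c t = 1 := by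
  rw [← NNReal.coe_mul, ← c_mul, inv_mul_cancel, c_one, NNReal.coe_one]

/-! ### The model Frobenioid `C := ModelFrobenioid Φ 0_D 0` (Thm. 5.2) -/

/-- The rational function monoid of the witness: `B = 0_D`. [cite: MochizukiFrdI2008, Thm. 5.2 p.100] -/
abbrev B : Dᵒᵖ ⥤ CommMonCat.{0} := zeroMonoid D

/-- `Div_B : 0_D → Φ^gp`, the unique homomorphism. [cite: MochizukiFrdI2008, Thm. 5.2 p.100] -/
def DivB : B ⟶ monoidGp Φ where
  app A := CommMonCat.ofHom 1
  naturality A A' f := by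
    ext u
    change (1 : Algebra.GrothendieckGroup (Φ.obj A')) = (CommMonCat.Hom.hom ((monoidGp Φ).map f)) 1
    rw [map_one]
    rfl

/-- `Div_B` is trivial. [cite: MochizukiFrdI2008, Thm. 5.2 p.100] -/
@[simp] theorem divB_eq_one (A : Dᵒᵖ) (u : B.obj A) : divB Φ B DivB A u = 1 := rfl

/-- `0_D` is objectwise group-like. [cite: MochizukiFrdI2008, Thm. 5.2 p.100] -/
theorem isGroupLike_B : Objectwise (fun M _ => IsGroupLike M) FrdI.T42.DilatingWitness.B := fun A =>
  { isPreDivisorial := (isDivisorial_zeroMonoid (D := D) A).isPreDivisorial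
    subsingleton_associates := ⟨fun a b => by
      obtain ⟨a, rfl⟩ := Associates.mk_surjective a
      obtain ⟨b, rfl⟩ := Associates.mk_surjective b
      rw [Subsingleton.elim a b]⟩ }

/-- `BΓ` is connected. [cite: MochizukiFrdI2008, Def. 1.1(iv) p.20] -/
theorem isGraphConnected_D : IsGraphConnected FrdI.T42.DilatingWitness.D := ⟨⟨SingleObj.star Γ⟩, fun X _ => Zigzag.refl X⟩

/-- `BΓ` is totally epimorphic (a groupoid). [cite: MochizukiFrdI2008, Def. 1.1(iv) p.20] -/
theorem isTotallyEpimorphic_D : IsTotallyEpimorphic FrdI.T42.DilatingWitness.D := ⟨fun _ => inferInstance⟩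

/-- **The Frobenioid of the witness**: the model Frobenioid of `(BΓ, Φ, 0_D)`.
[cite: MochizukiFrdI2008, Thm. 5.2(i) p.100] -/
abbrev C : Type := ModelFrobenioid Φ B DivB

/-- Its pre-Frobenioid structure `C → F_Φ`. [cite: MochizukiFrdI2008, Thm. 5.2(i) p.100] -/
abbrev F : C ⥤ ElemFrobenioid Φ := ModelFrobenioid.toElem Φ B DivB

/-- `C` is a Frobenioid (Thm. 5.2 (ii)). [cite: MochizukiFrdI2008, Thm. 5.2(ii) p.101] -/
theorem isFrobenioid : PreFrobenioid.IsFrobenioid FrdI.T42.DilatingWitness.F :=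
  ModelFrobenioid.isFrobenioid isMonoidOn_Φ isDivisorial_Φ isMonoidOn_zeroMonoid isGroupLike_B
    isGraphConnected_D isTotallyEpimorphic_D

/-- `C` is of isotropic type (Thm. 5.2 (ii)). [cite: MochizukiFrdI2008, Thm. 5.2(ii) p.101] -/
theorem isOfIsotropicType : PreFrobenioid.IsOfIsotropicType FrdI.T42.DilatingWitness.F := ModelFrobenioid.isOfIsotropicType isGroupLike_B

/-! ### Real coordinates: `(ℝ_{≥0})^gp ≅ ℝ`, the class `crd X ∈ ℝ` of an object, the relation of an arrow -/

/-- `(ℝ_{≥0})^gp → ℝ`, `[a]/[b] ↦ a − b` (multiplicative rendering). [cite: MochizukiFrdI2008, §0 p.11] -/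
def toR : Algebra.GrothendieckGroup (Multiplicative ℝ≥0) →* Multiplicative ℝ :=
  Algebra.GrothendieckGroup.lift (NNReal.toRealHom.toAddMonoidHom.toMultiplicative)

/-- `toR` is bijective (abc-iut-L1-d2's `nnrealGp_lift_bijective`). [cite: MochizukiFrdI2008, §0 p.11] -/
theorem toR_bijective : Bijective toR := nnrealGp_lift_bijective

/-- `toR [x] = v x`. [cite: MochizukiFrdI2008, §0 p.11] -/
theorem toR_of (x : Multiplicative ℝ≥0) :
    toR (Algebra.GrothendieckGroup.of x) = Multiplicative.ofAdd (v x) :=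
  DFunLike.congr_fun (Algebra.GrothendieckGroup.lift.symm_apply_apply _) x

/-- `(ℝ_{≥0})^gp ≅ ℝ` as an isomorphism of groups. [cite: MochizukiFrdI2008, §0 p.11] -/
def toRIso : Algebra.GrothendieckGroup (Multiplicative ℝ≥0) ≃* Multiplicative ℝ := MulEquiv.ofBijective toR toR_bijective

/-- The class `[r] ∈ (ℝ_{≥0})^gp` of a real number. [cite: MochizukiFrdI2008, §0 p.11] -/
def gpOfReal (r : ℝ) : Algebra.GrothendieckGroup (Multiplicative ℝ≥0) := toRIso.symm (Multiplicative.ofAdd r)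

/-- `toR [r] = r`. [cite: MochizukiFrdI2008, §0 p.11] -/
@[simp] theorem toR_gpOfReal (r : ℝ) : toR (gpOfReal r) = Multiplicative.ofAdd r := toRIso.apply_symm_apply _

/-- `toR` after `Φ(t)^gp`: `toR (t^* g) = e^t · toR g`. [cite: MochizukiFrdI2008, Thm. 5.2(i) p.100] -/
theorem toAdd_toR_pullGp {X Y : D} (t : X ⟶ Y) (g : Algebra.GrothendieckGroup (Φ.obj (op Y))) :
    Multiplicative.toAdd (toR (pullGp Φ t g)) = c t * Multiplicative.toAdd (toR g) := by
  let sc : Multiplicative ℝ →* Multiplicative ℝ := (AddMonoidHom.mulLeft (c t : ℝ)).toMultiplicative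
  have h : toR.comp (pullGp Φ t) = sc.comp toR := MonGp.hom_ext fun a => by
    rw [MonoidHom.comp_apply, MonoidHom.comp_apply, pullGp_of, toR_of, toR_of]
    exact congrArg Multiplicative.ofAdd (v_pull t a)
  exact congrArg Multiplicative.toAdd (DFunLike.congr_fun h g)

/-- The real coordinate `a` of an object `(∗, [a])`. [cite: MochizukiFrdI2008, Thm. 5.2(i) p.100] -/
def crd (X : C) : ℝ := Multiplicative.toAdd (toR X.cls)

/-- The object `(∗, [a])` with coordinate `a ∈ ℝ`. [cite: MochizukiFrdI2008, Thm. 5.2(i) p.100] -/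
def obj (a : ℝ) : C := ⟨SingleObj.star Γ, gpOfReal a⟩

/-- `crd (obj a) = a`. [cite: MochizukiFrdI2008, Thm. 5.2(i) p.100] -/
@[simp] theorem crd_obj (a : ℝ) : crd (obj a) = a := by rw [crd, obj, toR_gpOfReal, toAdd_ofAdd]

/-- Every object is `(∗, [crd X])`. [cite: MochizukiFrdI2008, Thm. 5.2(i) p.100] -/
theorem eq_obj_crd (X : C) : X = obj (crd X) := by
  obtain ⟨b, g⟩ := X
  change (⟨b, g⟩ : C) = ⟨SingleObj.star Γ, gpOfReal (Multiplicative.toAdd (toR g))⟩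
  congr 1
  exact toR_bijective.1 (by rw [toR_gpOfReal, ofAdd_toAdd])

/-- **The relation of an arrow in coordinates**: `(n, t, Z) : (∗,[a]) → (∗,[b])` satisfies `n·a + Z = e^t·b`.
[cite: MochizukiFrdI2008, Thm. 5.2(i) p.100] -/
theorem rel_crd {X Y : C} (φ : X ⟶ Y) :
    (ModelFrobenioid.degFr φ : ℝ) * crd X + v (ModelFrobenioid.div φ) = c (ModelFrobenioid.baseMap φ) * crd Y := by
  have h := congrArg (fun g => Multiplicative.toAdd (toR g)) (ModelFrobenioid.rel φ)
  dsimp only at h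
  rw [map_mul, map_pow, toR_of, toAdd_mul, toAdd_pow, toAdd_ofAdd, nsmul_eq_mul, map_mul, toAdd_mul,
    toAdd_toR_pullGp, divB_eq_one, map_one, toAdd_one, add_zero] at h
  exact h

/-- Two co-objective arrows of `C` with the same Frobenius degree and the same projection to `BΓ` are equal
(their divisors agree by the relation, `B = 0`). [cite: MochizukiFrdI2008, Thm. 5.2(i) p.100] -/
theorem hom_eq {X Y : C} (φ ψ : X ⟶ Y) (h₁ : ModelFrobenioid.degFr φ = ModelFrobenioid.degFr ψ)
    (h₂ : ModelFrobenioid.baseMap φ = ModelFrobenioid.baseMap ψ) : φ = ψ := by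
  refine ModelFrobenioid.hom_ext h₁ h₂ (v_injective ?_) (Subsingleton.elim _ _)
  have hφ := rel_crd φ
  have hψ := rel_crd ψ
  rw [h₁, h₂] at hφ
  linarith

/-- Constructor of arrows `(n, t, Z) : X → Y` from the relation in coordinates.
[cite: MochizukiFrdI2008, Thm. 5.2(i) p.100] -/
def homOf (X Y : C) (n : ℕ+) (t : Γ) (Z : ℝ) (hZ : 0 ≤ Z) (h : (n : ℝ) * crd X + Z = c t * crd Y) : X ⟶ Y :=
  ModelFrobenioid.mkHom X Y n (show X.base ⟶ Y.base from t) (ofReal Z hZ) 1 (toR_bijective.1 (by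
    apply Multiplicative.toAdd.injective
    rw [map_mul, map_pow, toR_of, toAdd_mul, toAdd_pow, toAdd_ofAdd, nsmul_eq_mul, v_ofReal, map_mul, toAdd_mul,
      toAdd_toR_pullGp, divB_eq_one, map_one, toAdd_one, add_zero]
    exact h))

/-- Components of `homOf`. [cite: MochizukiFrdI2008, Thm. 5.2(i) p.100] -/
@[simp] theorem degFr_homOf (X Y : C) (n : ℕ+) (t : Γ) (Z : ℝ) (hZ h) :
    ModelFrobenioid.degFr (homOf X Y n t Z hZ h) = n := rfl

/-- Components of `homOf`. [cite: MochizukiFrdI2008, Thm. 5.2(i) p.100] -/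
@[simp] theorem baseMap_homOf (X Y : C) (n : ℕ+) (t : Γ) (Z : ℝ) (hZ h) :
    ModelFrobenioid.baseMap (homOf X Y n t Z hZ h) = t := rfl

/-- Components of `homOf`. [cite: MochizukiFrdI2008, Thm. 5.2(i) p.100] -/
@[simp] theorem v_div_homOf (X Y : C) (n : ℕ+) (t : Γ) (Z : ℝ) (hZ h) :
    v (ModelFrobenioid.div (homOf X Y n t Z hZ h)) = Z := rfl

/-! ### Dictionary: isomorphisms, pre-steps, Frobenius type, pull-backs, Div-identity, in coordinates -/

/-- `deg_Fr` through `C → F_Φ`. [cite: MochizukiFrdI2008, Thm. 5.2(i) p.100] -/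
theorem degFr_F {X Y : C} (φ : X ⟶ Y) : PreFrobenioid.degFr F φ = ModelFrobenioid.degFr φ := rfl

/-- Every arrow of `C` is a base-isomorphism (`BΓ` is a groupoid). [cite: MochizukiFrdI2008, Def. 1.2(ii) p.22] -/
theorem isBaseIso {X Y : C} (φ : X ⟶ Y) : PreFrobenioid.IsBaseIso F φ :=
  (inferInstance : IsIso (ModelFrobenioid.baseMap φ))

/-- An arrow of `C` is an isomorphism iff `n = 1` and `Z = 0`. [cite: MochizukiFrdI2008, Thm. 5.2(ii) p.101] -/
theorem isIso_iff {X Y : C} (φ : X ⟶ Y) :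
    IsIso φ ↔ ModelFrobenioid.degFr φ = 1 ∧ ModelFrobenioid.div φ = 1 :=
  ⟨fun _ => ⟨ModelFrobenioid.degFr_eq_one_of_isIso φ, ModelFrobenioid.div_eq_one_of_isIso isDivisorial_Φ φ⟩,
    fun h => ModelFrobenioid.isIso_of isGroupLike_B φ h.2 h.1⟩

/-- An arrow of `C` is a pre-step iff `n = 1`. [cite: MochizukiFrdI2008, Def. 1.2(iii) p.22] -/
theorem isPreStep_iff {X Y : C} (φ : X ⟶ Y) : PreFrobenioid.IsPreStep F φ ↔ ModelFrobenioid.degFr φ = 1 :=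
  ⟨fun h => h.1, fun h => ⟨h, isBaseIso φ⟩⟩

/-- An arrow of `C` is of Frobenius type iff `Z = 0` (co-angularity is automatic, Thm. 5.2 (ii)).
[cite: MochizukiFrdI2008, Def. 1.2(iii) p.23] -/
theorem isFrobeniusType_iff {X Y : C} (φ : X ⟶ Y) :
    PreFrobenioid.IsFrobeniusType F φ ↔ ModelFrobenioid.div φ = 1 :=
  ⟨fun h => h.1.2, fun h => ⟨⟨ModelFrobenioid.isCoAngular isGroupLike_B φ, h⟩, isBaseIso φ⟩⟩

/-- An arrow of `C` is a pull-back morphism iff it is an isomorphism (Remark 1.2.1: every arrow is a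
base-isomorphism). [cite: MochizukiFrdI2008, Rem. 1.2.1 p.24] -/
theorem isPullbackMorphism_iff {X Y : C} (φ : X ⟶ Y) : PreFrobenioid.IsPullbackMorphism F φ ↔ IsIso φ :=
  ⟨fun h => (PreFrobenioid.isPullbackMorphism_and_isBaseIso_iff_isIso F φ).1 ⟨h, isBaseIso φ⟩,
    fun _ => PreFrobenioid.isPullbackMorphism_of_isIso F φ⟩

/-- An endomorphism `(n, t, Z)` of `C` is a Div-identity endomorphism iff `e^t = 1`.
[cite: MochizukiFrdI2008, Def. 1.2(ii) p.22] -/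
theorem isDivIdentity_iff {X : C} (φ : X ⟶ X) :
    PreFrobenioid.IsDivIdentity F φ ↔ (c (ModelFrobenioid.baseMap φ) : ℝ) = 1 := by
  constructor
  · intro h
    have h1 := congrArg (fun g => v (g (ofReal 1 zero_le_one))) h
    dsimp only at h1
    rwa [MonoidHom.id_apply, v_pull, v_ofReal, mul_one, ModelFrobenioid.base_toElem] at h1
  · intro h
    refine MonoidHom.ext fun x => v_injective ?_
    rw [MonoidHom.id_apply, v_pull, ModelFrobenioid.base_toElem, h, one_mul]

/-! ### `C` is of perfect type -/

/-- **`C` is of perfect type** (Def. 1.2 (iv)/(v)): `ℝ_{≥0}` is divisible, so `(∗,[b/n]) → (∗,[b])`, `(n, 1, 0)`,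
is a morphism of Frobenius type of degree `n`, and pre-steps descend uniquely along pairs of such morphisms
(the descended pre-step `(1, t₁ t' t₂⁻¹, e^{t₁} Z'/n)`; uniqueness from `hom_eq`).
[cite: MochizukiFrdI2008, Def. 1.2(iv) p.23] -/
theorem isOfPerfectType : PreFrobenioid.IsOfPerfectType FrdI.T42.DilatingWitness.F := by
  intro A n
  refine ⟨fun Y _ => ?_, fun B₁ B₁' B₂ B₂' φ₁ φ₂ _ _ hφ₁ hn₁ hφ₂ hn₂ ψ' hψ' => ?_⟩
  · have hn : (n : ℝ) ≠ 0 := Nat.cast_ne_zero.2 n.pos.ne'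
    refine ⟨obj (crd Y / n), homOf _ _ n 1 0 le_rfl ?_, (isFrobeniusType_iff _).2 ((v_eq_zero_iff _).1 rfl), rfl⟩
    rw [crd_obj, c_one, NNReal.coe_one, one_mul, add_zero, mul_div_cancel₀ _ hn]
  · have hn : (0 : ℝ) < n := Nat.cast_pos.2 n.pos
    rw [degFr_F] at hn₁ hn₂
    have hd' : ModelFrobenioid.degFr ψ' = 1 := hψ'.1
    -- the projections to `BΓ = Γ`
    let t₁ : Γ := ModelFrobenioid.baseMap φ₁
    let t₂ : Γ := ModelFrobenioid.baseMap φ₂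
    let t' : Γ := ModelFrobenioid.baseMap ψ'
    let t : Γ := t₁ * t' * t₂⁻¹
    -- the relations in coordinates
    have r₁ : (n : ℝ) * crd B₁ = c t₁ * crd B₁' := by
      have r := rel_crd φ₁
      rwa [hn₁, (v_eq_zero_iff _).2 ((isFrobeniusType_iff _).1 hφ₁), add_zero] at r
    have r₂ : (n : ℝ) * crd B₂ = c t₂ * crd B₂' := by
      have r := rel_crd φ₂
      rwa [hn₂, (v_eq_zero_iff _).2 ((isFrobeniusType_iff _).1 hφ₂), add_zero] at r
    have r' : crd B₁' + v (ModelFrobenioid.div ψ') = c t' * crd B₂' := by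
      have r := rel_crd ψ'
      rwa [hd', PNat.one_coe, Nat.cast_one, one_mul] at r
    have hct : (c t : ℝ) * c t₂ = c t₁ * c t' := by
      change (c (t₁ * t' * t₂⁻¹) : ℝ) * c t₂ = c t₁ * c t'
      rw [c_mul, c_mul, NNReal.coe_mul, NNReal.coe_mul, mul_assoc, c_inv_mul, mul_one]
    -- the descended divisor `Z = e^t b₂ − b₁ = e^{t₁} Z' / n ≥ 0`
    have hZ : (n : ℝ) * (c t * crd B₂ - crd B₁) = c t₁ * v (ModelFrobenioid.div ψ') := by
      linear_combination (c t : ℝ) * r₂ + crd B₂' * hct - (c t₁ : ℝ) * r' - r₁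
    have hZ0 : 0 ≤ c t * crd B₂ - crd B₁ :=
      nonneg_of_mul_nonneg_right (by rw [hZ]; exact mul_nonneg (c_pos t₁).le (v_nonneg _)) hn
    let ψ : B₁ ⟶ B₂ := homOf B₁ B₂ 1 t _ hZ0 (by rw [PNat.one_coe, Nat.cast_one, one_mul, add_sub_cancel])
    -- `χ ≫ φ₂ = φ₁ ≫ ψ'` iff `χ = (1, t, ·)`
    have hbase : ∀ χ : B₁ ⟶ B₂, χ ≫ φ₂ = φ₁ ≫ ψ' ↔ ModelFrobenioid.degFr χ = 1 ∧
        (ModelFrobenioid.baseMap χ : Γ) = t := fun χ => by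
      constructor
      · intro hχ
        have hd := congrArg ModelFrobenioid.degFr hχ
        have hb := congrArg ModelFrobenioid.baseMap hχ
        rw [ModelFrobenioid.degFr_comp, ModelFrobenioid.degFr_comp, hn₂, hn₁, hd', one_mul] at hd
        rw [ModelFrobenioid.baseMap_comp, ModelFrobenioid.baseMap_comp] at hb
        change t₂ * (ModelFrobenioid.baseMap χ : Γ) = t' * t₁ at hb
        refine ⟨mul_eq_left.1 hd, ?_⟩
        calc (ModelFrobenioid.baseMap χ : Γ) = t₂⁻¹ * (t₂ * ModelFrobenioid.baseMap χ) := by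
              rw [inv_mul_cancel_left]
          _ = t₂⁻¹ * (t' * t₁) := by rw [hb]
          _ = t₁ * t' * t₂⁻¹ := by rw [mul_comm, mul_comm t' t₁]
      · rintro ⟨hd, hb⟩
        refine hom_eq _ _ ?_ ?_
        · rw [ModelFrobenioid.degFr_comp, ModelFrobenioid.degFr_comp, hn₂, hn₁, hd, hd', mul_one, one_mul]
        · rw [ModelFrobenioid.baseMap_comp, ModelFrobenioid.baseMap_comp]
          change t₂ * (ModelFrobenioid.baseMap χ : Γ) = t' * t₁
          rw [hb]
          apply Multiplicative.toAdd.injective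
          rw [toAdd_mul, toAdd_mul, toAdd_mul, toAdd_mul, toAdd_inv]
          ring
    refine ⟨ψ, ⟨(isPreStep_iff _).2 rfl, (hbase ψ).2 ⟨rfl, rfl⟩⟩, fun χ hχ => ?_⟩
    obtain ⟨hd, hb⟩ := (hbase χ).1 hχ.2
    exact hom_eq _ _ hd hb

end FrdI.T42.DilatingWitness

end Literature.AlgebraicGeometry.Frobenioids
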